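import Literature.Probability.Percolation.LongRangeGoodBlocks
import Literature.Probability.Percolation.UniquenessInfiniteCluster
import Literature.Probability.LatticeModels.ProdBernoulliIndependence
import HarnessLib

/-!
# Long-range bond percolation on `ℤ`: translation invariance of block events, closed cylinders

Topic `Literature/Probability/Percolation`; companion of `LongRangeGoodBlocks.lean` for the
measure-theoretic but model-independent steps of Duminil-Copin–Garban–Tassion's proof of the
existence of a transition (*Long-range models in 1D revisited*, AIHP 60 (2024), §2.3), stated
for an arbitrary independent bond model `prodBernoulli P` on `BondConfig ℤ` whose edge
probabilities `P` are invariant under the relevant translation: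

* `locCluster_relabel_addRight`, `blkCluster_relabel`, `relabel_mem_good_iff`,
  `preimage_relabel_good` / `preimage_relabel_bad` — translating a configuration by `K t` sites
  (`BondConfig.relabel (sym2Equiv (Equiv.addRight (K t)))`, the tree's relabelling of
  `BondPercolationSymmetry.lean` / `reachable_relabel_iff`) carries block clusters of `B^j_K` onto
  block clusters of `B^{j+t}_K`, hence `good K θ (j + t)` onto `good K θ j`;
* `prodBernoulli_real_good_add`, `prodBernoulli_real_bad_add` — so `P[B^{j+t}_K is θ-bad] =
  P[B^j_K is θ-bad]` under translation-invariant parameters ("First using the estimate above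
  and then translation invariance …"; also the tacit `ℙ_{β,λ}[E_i] ≤ p_{β,λ}(K, θ)`);
* `prodBernoulli_real_forall_mk_notMem` — the probability that all edges between two disjoint
  finite vertex sets `S`, `T` are closed is `∏_{x ∈ S} ∏_{y ∈ T} (1 - P{x,y})` (the identity
  `P(𝐂⁻, 𝐂⁺) := ∏_{x ∈ 𝐂⁻} ∏_{y ∈ 𝐂⁺} e^{-β J_{x,y}}` of (2.7), for general parameters).

## References

* H. Duminil-Copin, C. Garban, V. Tassion, *Long-range models in 1D revisited*, AIHP 60 (2024)
  232–241, arXiv:2011.04642: §2.3 (proof of Lemma 2, (2.7); proof of Thm. 1(i), (2.10)).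
* G. Grimmett, *Percolation*, 2nd ed. 1999, §1.3 p. 10 (product measure, invariance).
-/

noncomputable section

open scoped Classical

namespace Literature.Probability.Percolation

open SimpleGraph Finset _root_.MeasureTheory Literature.Probability.LatticeModels

/-! ### Translating configurations -/

/-- Translating a configuration translates local clusters: with `e = (· + s)` and
`σ = sym2Equiv e`, the cluster of `e x` in `e(S)` through `σ(E)` for `σ '' ω` is the translate
of the cluster of `x` in `S` through `E` for `ω`. [folklore] -/
theorem locCluster_relabel_addRight (s : ℤ) (ω : BondConfig ℤ) (E : Set (Sym2 ℤ)) (S : Finset ℤ)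
    (x : ℤ) :
    locCluster (BondConfig.relabel (sym2Equiv (Equiv.addRight s)) ω)
        (sym2Equiv (Equiv.addRight s) '' E) (S.map (addRightEmbedding s)) (x + s) =
      (locCluster ω E S x).map (addRightEmbedding s) := by
  set e := Equiv.addRight s with he
  ext y'
  rw [mem_locCluster, Finset.mem_map]
  simp only [Finset.mem_map, addRightEmbedding_apply, mem_locCluster]
  have hinter : BondConfig.relabel (sym2Equiv e) ω ∩ sym2Equiv e '' E =
      BondConfig.relabel (sym2Equiv e) (ω ∩ E) := by
    rw [BondConfig.relabel_apply, BondConfig.relabel_apply, Set.image_inter (sym2Equiv e).injective]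
  constructor
  · rintro ⟨⟨y, hy, rfl⟩, hr⟩
    refine ⟨y, ⟨hy, ?_⟩, rfl⟩
    rw [hinter] at hr
    exact (reachable_relabel_iff e (ω ∩ E) x y).1 hr
  · rintro ⟨y, ⟨hy, hr⟩, rfl⟩
    refine ⟨⟨y, hy, rfl⟩, ?_⟩
    rw [hinter]
    exact (reachable_relabel_iff e (ω ∩ E) x y).2 hr

/-- Translating by `K t` sites carries `B^j_K` onto `B^{j+t}_K`. [folklore] -/
theorem blk_map_addRight (K : ℕ) (j t : ℤ) :
    (blk K j).map (addRightEmbedding ((K : ℤ) * t)) = blk K (j + t) := by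
  rw [blk, blk, Finset.map_add_right_Ico]
  congr 1 <;> ring

/-- Translating by `K t` sites carries the edges inside `B^j_K` onto those inside `B^{j+t}_K`.
[folklore] -/
theorem image_blkEdges_addRight (K : ℕ) (j t : ℤ) :
    sym2Equiv (Equiv.addRight ((K : ℤ) * t)) '' blkEdges K j = blkEdges K (j + t) := by
  ext z
  constructor
  · rintro ⟨w, hw, rfl⟩
    induction w using Sym2.ind with
    | h a b =>
      rw [mk_mem_blkEdges, mem_blk, mem_blk] at hw
      rw [sym2Equiv_mk, mk_mem_blkEdges, mem_blk, mem_blk]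
      simp only [Equiv.coe_addRight]
      refine ⟨⟨?_, ?_⟩, ⟨?_, ?_⟩⟩ <;> nlinarith [hw.1.1, hw.1.2, hw.2.1, hw.2.2]
  · intro hz
    induction z using Sym2.ind with
    | h a b =>
      rw [mk_mem_blkEdges, mem_blk, mem_blk] at hz
      refine ⟨s(a - K * t, b - K * t), ?_, ?_⟩
      · rw [mk_mem_blkEdges, mem_blk, mem_blk]
        refine ⟨⟨?_, ?_⟩, ⟨?_, ?_⟩⟩ <;> nlinarith [hz.1.1, hz.1.2, hz.2.1, hz.2.2]
      · rw [sym2Equiv_mk]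
        simp only [Equiv.coe_addRight, sub_add_cancel]

/-- **Translation carries block clusters to block clusters**: the cluster of `x + Kt` in
`B^{j+t}_K` for the translated configuration is the translate of the cluster of `x` in `B^j_K`.
[folklore] -/
theorem blkCluster_relabel (K : ℕ) (j t : ℤ) (ω : BondConfig ℤ) (x : ℤ) :
    blkCluster (BondConfig.relabel (sym2Equiv (Equiv.addRight ((K : ℤ) * t))) ω) K (j + t)
        (x + (K : ℤ) * t) =
      (blkCluster ω K j x).map (addRightEmbedding ((K : ℤ) * t)) := by
  show locCluster _ (blkEdges K (j + t)) (blk K (j + t)) _ = _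
  rw [← image_blkEdges_addRight K j t, ← blk_map_addRight K j t]
  exact locCluster_relabel_addRight _ ω _ _ x

/-- **Translation invariance of goodness**: the translate by `K t` of `ω` has a `θ`-good block
`B^{j+t}_K` iff `ω` has a `θ`-good block `B^j_K`. [folklore] -/
theorem relabel_mem_good_iff (K : ℕ) (θ : ℝ) (j t : ℤ) (ω : BondConfig ℤ) :
    BondConfig.relabel (sym2Equiv (Equiv.addRight ((K : ℤ) * t))) ω ∈ good K θ (j + t) ↔
      ω ∈ good K θ j := by
  constructor
  · rintro ⟨x', hx', hcard⟩
    refine ⟨x' - K * t, ?_, ?_⟩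
    · rw [← blk_map_addRight K j t, Finset.mem_map] at hx'
      obtain ⟨x, hx, hxx'⟩ := hx'
      rw [addRightEmbedding_apply] at hxx'
      rwa [← hxx', add_sub_cancel_right]
    · have h := blkCluster_relabel K j t ω (x' - K * t)
      rw [sub_add_cancel] at h
      rwa [h, Finset.card_map] at hcard
  · rintro ⟨x, hx, hcard⟩
    refine ⟨x + K * t, ?_, ?_⟩
    · rw [← blk_map_addRight K j t, Finset.mem_map]
      exact ⟨x, hx, rfl⟩
    · rwa [blkCluster_relabel, Finset.card_map]

/-- Preimage form: translating by `K t` pulls `good K θ (j + t)` back to `good K θ j`. [folklore] -/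
theorem preimage_relabel_good (K : ℕ) (θ : ℝ) (j t : ℤ) :
    (fun ω : BondConfig ℤ => sym2Equiv (Equiv.addRight ((K : ℤ) * t)) '' ω) ⁻¹' good K θ (j + t) =
      good K θ j := by
  ext ω
  exact relabel_mem_good_iff K θ j t ω

/-- Preimage form for bad blocks. [folklore] -/
theorem preimage_relabel_bad (K : ℕ) (θ : ℝ) (j t : ℤ) :
    (fun ω : BondConfig ℤ => sym2Equiv (Equiv.addRight ((K : ℤ) * t)) '' ω) ⁻¹' bad K θ (j + t) =
      bad K θ j := by
  rw [bad, Set.preimage_compl, preimage_relabel_good, bad]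

/-- **`P[B^{j+t}_K is θ-good] = P[B^j_K is θ-good]`** for an independent bond model on `ℤ`
whose edge probabilities are invariant under the translation by `K t`.
[cite: DuminilcopinGarbanTassion2024, §2.3 (proof of Thm. 1(i), "translation invariance")] -/
theorem prodBernoulli_real_good_add (P : Sym2 ℤ → unitInterval) {K : ℕ} {t : ℤ}
    (hP : ∀ z, P (sym2Equiv (Equiv.addRight ((K : ℤ) * t)) z) = P z) (θ : ℝ) (j : ℤ) :
    (prodBernoulli P).real (good K θ (j + t)) = (prodBernoulli P).real (good K θ j) := by
  rw [← preimage_relabel_good K θ j t]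
  exact (prodBernoulli_real_preimage_image_equiv P _ hP (measurableSet_good K θ (j + t))).symm

/-- **`P[B^{j+t}_K is θ-bad] = P[B^j_K is θ-bad]`** under translation-invariant parameters
(so `p_{β,λ}(K, θ)` is the probability that *any* given `K`-block is `θ`-bad).
[cite: DuminilcopinGarbanTassion2024, §2.2 (p(K,θ)) and §2.3] -/
theorem prodBernoulli_real_bad_add (P : Sym2 ℤ → unitInterval) {K : ℕ} {t : ℤ}
    (hP : ∀ z, P (sym2Equiv (Equiv.addRight ((K : ℤ) * t)) z) = P z) (θ : ℝ) (j : ℤ) :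
    (prodBernoulli P).real (bad K θ (j + t)) = (prodBernoulli P).real (bad K θ j) := by
  rw [← preimage_relabel_bad K θ j t]
  exact (prodBernoulli_real_preimage_image_equiv P _ hP (measurableSet_bad K θ (j + t))).symm

/-! ### Closed cylinders between two vertex sets -/

/-- **All edges between the disjoint finite sets `S` and `T` are closed with probability
`∏_{x ∈ S} ∏_{y ∈ T} (1 - P{x,y})`** (product structure; the map `(x, y) ↦ {x, y}` is
injective on `S × T`). [cite: DuminilcopinGarbanTassion2024, §2.3 (proof of Lemma 2, (2.7))] -/
theorem prodBernoulli_real_forall_mk_notMem (P : Sym2 ℤ → unitInterval) {S T : Finset ℤ}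
    (hST : Disjoint S T) :
    (prodBernoulli P).real {ω | ∀ x ∈ S, ∀ y ∈ T, s(x, y) ∉ ω} =
      ∏ x ∈ S, ∏ y ∈ T, (1 - (P s(x, y) : ℝ)) := by
  set F : Finset (Sym2 ℤ) := (S ×ˢ T).image fun q => s(q.1, q.2) with hF
  have hev : {ω : BondConfig ℤ | ∀ x ∈ S, ∀ y ∈ T, s(x, y) ∉ ω} = {ω | ∀ z ∈ F, z ∉ ω} := by
    ext ω
    simp only [Set.mem_setOf_eq, hF, Finset.forall_mem_image, Finset.mem_product]
    constructor
    · rintro h ⟨x, y⟩ ⟨hx, hy⟩; exact h x hx y hy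
    · intro h x hx y hy; exact h (x := (x, y)) ⟨hx, hy⟩
  have hinj : Set.InjOn (fun q : ℤ × ℤ => s(q.1, q.2)) ↑(S ×ˢ T) := by
    rintro ⟨a, b⟩ hab ⟨a', b'⟩ hab' h
    rw [Finset.coe_product, Set.mem_prod] at hab hab'
    simp only at h
    rcases Sym2.eq_iff.1 h with ⟨rfl, rfl⟩ | ⟨rfl, rfl⟩
    · rfl
    · exact absurd hab.1 (Finset.disjoint_right.1 hST hab'.2)
  rw [hev, prodBernoulli_real_forall_notMem, hF, Finset.prod_image hinj, Finset.prod_product]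

end Literature.Probability.Percolation

end
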